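import Summits.AtomisticToContinuum.BoseEinsteinCondensation.Theses.BECHardSphereReduction
import Literature.MathematicalPhysics.QuantumManyBody.BoseGasThermodynamicLimitRuelle

/-!
# AtomisticToContinuum / BoseEinsteinCondensation — route `BECHardSphereReduction`, assembly

Settles the assembly item `stmt-AtomisticToContinuum-11889` of route
`route-AtomisticToContinuum-BECHardSphereReduction`: the implication
`HardCoreDominates → HardSphereBEC → BoseEinsteinCondensation`.

The hypotheses of `Assembly` are, verbatim and in the same order, those of the route's deciding
theorem `closes`, so the assembly is that theorem curried. For the record the composition is
replayed here self-containedly (`boseEinsteinCondensation_of_dominates_of_hardSphereBEC`): given a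
repulsive finite-range `v` with range `R₀`, put `R := max R₀ 1` (so `0 < R` and `v = 0` beyond `R`);
`HardCoreDominates v R` gives the dilute guard constant `η₀ > 0`, `HardSphereBEC R` gives a density
threshold `ρ₁ > 0` for the hard spheres of diameter `R`; for `0 < ρ < min ρ₁ (η₀ / R³)` the BEC
constant `c` of `HS_R` at density `ρ` works for `v`, because along `L_N = (N/ρ)^{1/3}` one has
`L_N³ = N/ρ` (`BoseGas.sideLength_pow_three`), hence `N R³ ≤ η₀ L_N³` from `ρ R³ ≤ η₀`, and then
`ofReal (c N) ≤ condensateNumber HS_R N L_N ≤ condensateNumber v N L_N`.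
Pure logic plus three lines of real arithmetic; no analytic content lives here.
-/

namespace Summit.AtomisticToContinuum.BoseEinsteinCondensation.Theorems

open Summit.AtomisticToContinuum.BoseEinsteinCondensation.Theses.BECHardSphereReduction
open Literature.MathematicalPhysics.QuantumManyBody

/-- The dilute guard of `HardCoreDominates` holds along the thermodynamic sequence once
`ρ R³ ≤ η₀`: `N R³ ≤ η₀ · (sideLength ρ N)³` for `0 < ρ`. [folklore] -/
theorem hardCoreGuard_along_sideLength {ρ η₀ R : ℝ} (hρ : 0 < ρ) (hρR : ρ * R ^ 3 ≤ η₀)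
    (N : ℕ) : (N : ℝ) * R ^ 3 ≤ η₀ * BoseGas.sideLength ρ N ^ 3 := by
  rw [BoseGas.sideLength_pow_three hρ]
  have hNρ : 0 ≤ (N : ℝ) / ρ := div_nonneg N.cast_nonneg hρ.le
  calc (N : ℝ) * R ^ 3 = (N : ℝ) / ρ * (ρ * R ^ 3) := by field_simp
    _ ≤ (N : ℝ) / ρ * η₀ := mul_le_mul_of_nonneg_left hρR hNρ
    _ = η₀ * ((N : ℝ) / ρ) := by ring

/-- The composition behind the route, self-contained: hard cores of the same range dominate
(`HardCoreDominates`) and dilute hard spheres condense (`HardSphereBEC`) together give the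
sub-problem statement `BoseEinsteinCondensation` — for `v` of range `R₀` take `R := max R₀ 1` and
`ρ₀ := min ρ₁ (η₀ / R³)`. [folklore] -/
theorem boseEinsteinCondensation_of_dominates_of_hardSphereBEC (h1 : HardCoreDominates)
    (h2 : HardSphereBEC) : _root_.BoseEinsteinCondensation := by
  intro v hv
  obtain ⟨hmeas, R₀, hR₀⟩ := hv
  set R : ℝ := max R₀ 1
  have hRpos : 0 < R := lt_of_lt_of_le one_pos (le_max_right _ _)
  have hvR : ∀ r : ℝ, R < r → v r = 0 := fun r hr => hR₀ r (lt_of_le_of_lt (le_max_left _ _) hr)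
  obtain ⟨η₀, hη₀, hdom⟩ := h1 v R hmeas hRpos hvR
  obtain ⟨ρ₁, hρ₁, hbec⟩ := h2 R hRpos
  have hR3 : 0 < R ^ 3 := pow_pos hRpos 3
  refine ⟨min ρ₁ (η₀ / R ^ 3), lt_min hρ₁ (div_pos hη₀ hR3), fun ρ hρ hρlt => ?_⟩
  have hρ₁' : ρ < ρ₁ := lt_of_lt_of_le hρlt (min_le_left _ _)
  have hρη : ρ < η₀ / R ^ 3 := lt_of_lt_of_le hρlt (min_le_right _ _)
  have hρR : ρ * R ^ 3 ≤ η₀ := ((lt_div_iff₀ hR3).1 hρη).le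
  obtain ⟨c, hc, hev⟩ := hbec ρ hρ hρ₁'
  exact ⟨c, hc, hev.mono fun N hN => hN.trans (hdom N _ (hardCoreGuard_along_sideLength hρ hρR N))⟩

/-- Settles `stmt-AtomisticToContinuum-11889` (exact signature): the assembly of route
`BECHardSphereReduction`, `HardCoreDominates → HardSphereBEC → BoseEinsteinCondensation` — the
route's deciding theorem `closes`, curried; proved here by the self-contained replay
`boseEinsteinCondensation_of_dominates_of_hardSphereBEC`. [folklore] -/
theorem becHardSphereReduction_assembly_proof :
    Summit.AtomisticToContinuum.BoseEinsteinCondensation.Theses.BECHardSphereReduction.Assembly := by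
  unfold Theses.BECHardSphereReduction.Assembly
  exact boseEinsteinCondensation_of_dominates_of_hardSphereBEC

end Summit.AtomisticToContinuum.BoseEinsteinCondensation.Theorems
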